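import Literature.NumberTheory.Sieve.Maynard2016MainChain
import Literature.NumberTheory.Sieve.Maynard2016ProbabilisticMethod
import HarnessLib

/-!
# Maynard 2016, §§3–4: Proposition 5′ and its reduction to GPY probability measures

Topic `Literature/NumberTheory/Sieve`. This file TYPES two further displayed statements of
J. Maynard, *Large gaps between primes*, Ann. of Math. 183 (2016), and PROVES the §3 reduction
between them:

* `Proposition5Prime` — the form of Proposition 5 actually established in §§3–8 (§3, first
  paragraph): "for any fixed `ε, δ > 0` and interval `𝓘_m ⊆ [x/2, x]` of length at least
  `δ|𝓡_m| log x`, we can choose residue classes `a_q (mod q)` for primes `q ∈ 𝓘_m` such that all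
  but `ε|𝓡_m|` elements `p` of `𝓡_m` satisfy `p ≡ a_q (mod q)` for some prime `q ∈ 𝓘_m`."
  (Maynard shows it is equivalent to Proposition 5 by appending an interval of length
  `2ε|𝓡_m| log x`; that equivalence also uses the prime number theorem on the appended interval and
  is not formalised here.) Named fact.
* `GPYMeasures` — the target of §4 ("GPY probabilities", first paragraph): "we require a
  probability measure `μ_{m,q}` for each prime `q ∈ 𝓘_m`, such that for almost every `p ∈ 𝓡_m` the
  expected number `Σ_{q∈𝓘_m} μ_{m,q}(p)` of times the residue class `p (mod q)` is chosen is at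
  least `t`, where `t` can be taken to be arbitrarily large." Named fact (this is what the
  multidimensional-sieve computations of §§5–8 deliver).
* `proposition5Prime_of_GPYMeasures` — **PROVED**: `GPYMeasures → Proposition5Prime`, by the
  derandomised probabilistic method `exists_choice_card_uncovered_le_exp`
  (`Maynard2016ProbabilisticMethod.lean`): the uncovered part of `𝓡_m` has size
  `≤ (η/2)|𝓡_m| + e^{−t}|𝓡_m| ≤ η|𝓡_m|` once `e^{−t} ≤ η/2`.
* `proposition5Prime_of_proposition5` — PROVED (the trivial direction of the equivalence).

## References

* J. Maynard, *Large gaps between primes*, Ann. of Math. (2) 183 (2016), 915–933; arXiv:1408.5110,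
  §3 (first paragraph and the probabilistic method), §4 (first paragraph). [Maynard2016LargeGaps]
-/

open Filter Finset
open scoped Topology

namespace Literature.NumberTheory.Sieve

namespace Maynard2016

/-- The prime moduli of the interval `[A, B]`: `{q prime : A ≤ q ≤ B}` as a finset of naturals.
[cite: Maynard2016LargeGaps, Proposition 5 («for each prime `q ∈ 𝓘_m`»)] -/
noncomputable def intervalPrimes (A B : ℝ) : Finset ℕ :=
  (Finset.Icc ⌈A⌉₊ ⌊B⌋₊).filter Nat.Prime

/-- Membership in `intervalPrimes`. [cite: Maynard2016LargeGaps, Proposition 5] -/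
theorem mem_intervalPrimes {A B : ℝ} {q : ℕ} (hB : 0 ≤ B) :
    q ∈ intervalPrimes A B ↔ q.Prime ∧ A ≤ (q : ℝ) ∧ (q : ℝ) ≤ B := by
  rw [intervalPrimes, mem_filter, mem_Icc, Nat.ceil_le, Nat.le_floor_iff hB]
  tauto

/-- **Maynard 2016, Proposition 5′** (§3: the "slightly different (but equivalent) form" in which
Proposition 5 is proved): for fixed `C_U > 0`, all sufficiently small `ε > 0`, every `δ > 0` and
`η > 0`, and all large `x`: for every even `m < U z⁻¹ (log₂ x)⁻²` and every interval
`[A, B] ⊆ [x/2, x]` of length `≥ δ |𝓡_m| log x` there are residue classes `a_q (mod q)`, `q` prime in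
`[A, B]` (`intervalPrimes A B`), such that all but at most `η |𝓡_m|` elements `p ∈ 𝓡_m` satisfy
`p ≡ a_q (mod q)` for some such `q`. Named fact, not proved here (§§4–8 of the paper). [cite: Maynard2016LargeGaps, §3 (first
paragraph)] -/
def Proposition5Prime : Prop :=
  ∀ C_U : ℝ, 0 < C_U → ∀ᶠ ε : ℝ in 𝓝[>] 0, ∀ δ : ℝ, 0 < δ → ∀ η : ℝ, 0 < η → ∀ᶠ x : ℕ in atTop,
    ∀ m : ℕ, 1 ≤ m → Even m → (m : ℝ) < U C_U ε x / (z x * (Real.log (Real.log x)) ^ 2) →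
      ∀ A B : ℝ, (x : ℝ) / 2 ≤ A → B ≤ x →
        δ * (Rm C_U ε x m).card * Real.log x ≤ B - A →
          ∃ a : ℕ → ℕ,
            (((Rm C_U ε x m).filter (fun p =>
                ¬ ∃ q ∈ intervalPrimes A B, p ≡ a q [MOD q])).card : ℝ) ≤
              η * (Rm C_U ε x m).card

/-- **The goal of §4 ("GPY probabilities")**: "we require a probability measure `μ_{m,q}` for each
prime `q ∈ 𝓘_m`, such that for almost every `p ∈ 𝓡_m` the expected number `Σ_{q ∈ 𝓘_m} μ_{m,q}(p)`
of times the residue class `p (mod q)` is chosen is at least `t`, where `t` can be taken to be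
arbitrarily large": for fixed `C_U > 0`, small `ε > 0`, every `δ, η > 0` and every `t`, for all
large `x`, every even `m < U z⁻¹(log₂ x)⁻²` and every `[A, B] ⊆ [x/2, x]` of length `≥ δ|𝓡_m| log x`,
there are weights `μ q (c) ≥ 0` (`c < q`) with `Σ_{c<q} μ q (c) = 1` for each prime `q ∈ [A, B]` such
that `Σ_q μ q (p mod q) ≥ t` for all but at most `η|𝓡_m|` elements `p ∈ 𝓡_m`. Named fact, not proved
here (§§5–8: the multidimensional sieve weights (4.1) and Propositions 6.1–6.2 of the paper).
[cite: Maynard2016LargeGaps, §4 (first paragraph)] -/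
def GPYMeasures : Prop :=
  ∀ C_U : ℝ, 0 < C_U → ∀ᶠ ε : ℝ in 𝓝[>] 0, ∀ δ : ℝ, 0 < δ → ∀ η : ℝ, 0 < η → ∀ t : ℝ,
    ∀ᶠ x : ℕ in atTop,
      ∀ m : ℕ, 1 ≤ m → Even m → (m : ℝ) < U C_U ε x / (z x * (Real.log (Real.log x)) ^ 2) →
        ∀ A B : ℝ, (x : ℝ) / 2 ≤ A → B ≤ x →
          δ * (Rm C_U ε x m).card * Real.log x ≤ B - A →
            ∃ μ : ℕ → ℕ → ℝ,
              (∀ q ∈ intervalPrimes A B, ∀ c ∈ Finset.range q, 0 ≤ μ q c) ∧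
              (∀ q ∈ intervalPrimes A B, ∑ c ∈ Finset.range q, μ q c = 1) ∧
              (((Rm C_U ε x m).filter (fun p =>
                  ∑ q ∈ intervalPrimes A B, μ q (p % q) < t)).card : ℝ) ≤
                η * (Rm C_U ε x m).card

/-! ### §3: `GPYMeasures → Proposition5Prime` -/

/-- **Maynard 2016, §3 (the probabilistic method), PROVED**: the GPY probability measures of §4 give
Proposition 5′ — choose `t` with `e^{−t} ≤ η/2` and apply the measures with exceptional proportion
`η/2`; by `exists_choice_card_uncovered_le_exp` some choice of classes leaves at most
`(η/2)|𝓡_m| + e^{−t}|𝓡_m| ≤ η|𝓡_m|` elements uncovered. [cite: Maynard2016LargeGaps, §3] -/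
theorem proposition5Prime_of_GPYMeasures (h : GPYMeasures) : Proposition5Prime := by
  classical
  intro C_U hC
  filter_upwards [h C_U hC] with ε hε
  intro δ hδ η hη
  -- `t = log(2/η)` gives `e^{−t} = η/2`
  set t : ℝ := Real.log (2 / η) with ht
  have hexp : Real.exp (-t) = η / 2 := by
    rw [ht, Real.exp_neg, Real.exp_log (by positivity)]
    field_simp
  filter_upwards [hε δ hδ (η / 2) (by positivity) t] with x hx
  intro m hm1 hmev hmW A B hA hB hlen
  obtain ⟨μ, hμ0, hμ1, hbad⟩ := hx m hm1 hmev hmW A B hA hB hlen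
  set R := Rm C_U ε x m with hR
  set Q := intervalPrimes A B with hQ
  set E := R.filter (fun p => ∑ q ∈ Q, μ q (p % q) < t) with hE
  have hcls : ∀ q ∈ Q, ∀ p ∈ R, p % q ∈ Finset.range q := by
    intro q hq p _
    have hqp : q.Prime := (mem_filter.1 hq).2
    exact mem_range.2 (Nat.mod_lt p hqp.pos)
  have htE : ∀ p ∈ R, p ∉ E → t ≤ ∑ q ∈ Q, μ q (p % q) := by
    intro p hp hpE
    by_contra hlt
    exact hpE (mem_filter.2 ⟨hp, not_le.1 hlt⟩)
  obtain ⟨a, ha⟩ := exists_choice_card_uncovered_le_exp Q (fun q => Finset.range q) μ hμ0 hμ1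
    R E (fun q p => p % q) hcls (fun _ => 0) t htE
  refine ⟨a, ?_⟩
  -- a target covered by some `q ∈ Q` (i.e. `p % q = a q`) satisfies the congruence
  have hB0 : 0 ≤ B := by
    have hx0 : (0 : ℝ) ≤ x := Nat.cast_nonneg x
    have hcard : (0 : ℝ) ≤ δ * (Rm C_U ε x m).card * Real.log x := by
      rcases Nat.eq_zero_or_pos x with h0 | h0
      · subst h0; simp
      · have : 0 ≤ Real.log (x : ℝ) := Real.log_nonneg (by exact_mod_cast h0)
        positivity
    linarith
  have hsub : R.filter (fun p => ¬ ∃ q ∈ intervalPrimes A B, p ≡ a q [MOD q]) ⊆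
      R.filter (fun p => ∀ q ∈ Q, p % q ≠ a q) := by
    intro p hp
    rw [mem_filter] at hp ⊢
    refine ⟨hp.1, fun q hq hpq => hp.2 ?_⟩
    have hq' := (mem_intervalPrimes hB0).1 hq
    refine ⟨q, hq, ?_⟩
    -- `a q = p % q < q`, so `p ≡ a q (mod q)`
    have hlt : a q < q := by rw [← hpq]; exact Nat.mod_lt p hq'.1.pos
    show p % q = a q % q
    rw [Nat.mod_eq_of_lt hlt, hpq]
  have hRE : ((R ∩ E).card : ℝ) ≤ η / 2 * R.card := by
    have : R ∩ E = E := by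
      rw [hE, ← filter_mem_eq_inter]
      ext p; simp [mem_filter]
    rw [this]; exact hbad
  calc (((R.filter (fun p => ¬ ∃ q ∈ intervalPrimes A B, p ≡ a q [MOD q])).card : ℝ))
      ≤ ((R.filter (fun p => ∀ q ∈ Q, p % q ≠ a q)).card : ℝ) := by
        exact_mod_cast card_le_card hsub
    _ ≤ ((R ∩ E).card : ℝ) + Real.exp (-t) * R.card := ha
    _ ≤ η / 2 * R.card + η / 2 * R.card := by rw [hexp]; linarith
    _ = η * R.card := by ring

/-- The trivial direction: Proposition 5 (full cover) implies Proposition 5′ (all but `η|𝓡_m|`).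
[cite: Maynard2016LargeGaps, §3 (first paragraph: «these two forms of Proposition 5 are
equivalent»)] -/
theorem proposition5Prime_of_proposition5 (h : Proposition5) : Proposition5Prime := by
  classical
  intro C_U hC
  filter_upwards [h C_U hC] with ε hε
  intro δ hδ η hη
  filter_upwards [hε δ hδ] with x hx
  intro m hm1 hmev hmW A B hA hB hlen
  obtain ⟨a, ha⟩ := hx m hm1 hmev hmW A B hA hB hlen
  refine ⟨a, ?_⟩
  have hB0 : 0 ≤ B := by
    have hx0 : (0 : ℝ) ≤ x := Nat.cast_nonneg x
    have hcard : (0 : ℝ) ≤ δ * (Rm C_U ε x m).card * Real.log x := by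
      rcases Nat.eq_zero_or_pos x with h0 | h0
      · subst h0; simp
      · have : 0 ≤ Real.log (x : ℝ) := Real.log_nonneg (by exact_mod_cast h0)
        positivity
    linarith
  have h0 : (Rm C_U ε x m).filter (fun p => ¬ ∃ q ∈ intervalPrimes A B, p ≡ a q [MOD q]) = ∅ := by
    rw [filter_eq_empty_iff]
    intro p hp hnot
    obtain ⟨q, hq, hAq, hqB, hpq⟩ := ha p hp
    exact hnot ⟨q, (mem_intervalPrimes hB0).2 ⟨hq, hAq, hqB⟩, hpq⟩
  rw [h0, card_empty, Nat.cast_zero]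
  positivity

/-- Hence the inputs of Theorem 1 are: Lemma 2, Lemma 3, the GPY measures of §4, and the
equivalence Proposition 5′ ⇒ Proposition 5 of §3. [cite: Maynard2016LargeGaps, Thm 1] -/
example (h₂ : Lemma2) (h₃ : Lemma3) (hμ : GPYMeasures)
    (hequiv : Proposition5Prime → Proposition5) : Maynard2016_theorem1 :=
  theorem1_of_lemmas h₂ h₃ (hequiv (proposition5Prime_of_GPYMeasures hμ))

end Maynard2016

end Literature.NumberTheory.Sieve
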